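import Summits.NavierStokesRegularity.NavierStokesRegularity.Theorems.TypeICertificateLadderTargetStrainCubeLambSplit
import HarnessLib

/-!
# Crux `Target` = `TypeICertificateLadder.NoTypeIBlowup` (stmt-NavierStokesRegularity-1217), line
# `depletion-ladder`: THE TWO-AMPLITUDE SPLIT — the Lamb share is charged to the NORMAL velocity only

`--supports stmt-NavierStokesRegularity-1217` (helper; refines p583881 / p584399 by the observation of p586774).
Author: STA lineage `ns-sta-19551-p1` (g11).

In the joint pointwise bound of the split the auxiliary vector is `z = ±α (v × ω) ± β v`, with
`‖z‖² = α²‖v × ω‖² + β²‖v‖²` EXACTLY (`v × ω ⊥ v`): the Lamb share sees only `‖v × ω‖ ≤ M_⊥‖ω‖`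
(`M_⊥` = sup of the velocity component normal to the vorticity), the strain-cube share the full `‖v‖ ≤ M`.
Keeping the two amplitudes apart —
`abs_lamb_add_abs_axial_le_normSq`, `lamb_split_pointwise_normal`, `lamb_split_weight_le_normal`: the joint,
pointwise and fixed-weight bounds with `(1−λ)²M_⊥²‖ω‖²` in place of `(1−λ)²M²‖ω‖²` inside the square root.
Limit, two-amplitude inequality `|J| ≤ (√((1−λ)²M_⊥² + λ²M²/27) + 2λM/9)‖ω‖₂‖∇ω‖₂` and the two-rate rung:
`…StrainCubeLambSplitNormalDepletion`. WHAT THIS IS NOT: kinematics of one slice. [folklore]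
-/

noncomputable section

open Set Function Filter Topology MeasureTheory Finset
open scoped RealInnerProductSpace ENNReal NNReal Laplacian ContDiff
open Literature.Analysis.FluidPDE

namespace Summit.NavierStokesRegularity.NavierStokesRegularity.Theorems.DepletionLadder.StrainCube

-- the problem directory repeats the summit name (`NavierStokesRegularity/NavierStokesRegularity`)
set_option linter.dupNamespace false

open Summit.NavierStokesRegularity.NavierStokesRegularity.Theorems.RungReynoldsOne
open Summit.NavierStokesRegularity.NavierStokesRegularity.Theorems.RungReynoldsOne.WeightedSlice
open Summit.NavierStokesRegularity.NavierStokesRegularity.Theorems.DepletionLadder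

/-! ## Pointwise algebra in `ℝ³`: the joint bound on two orthogonal pairings -/

/-- **The joint bound on the two orthogonal pairings, exact-norm form.** For `v, w, c ∈ ℝ³` and real `α, β`:
`α |⟪v, w × c⟫| + β |⟪v, c⟫| ≤ ‖c‖ · √(α²‖v × w‖² + β²‖v‖²)` (the Lamb pairing sees only `v × w`).
Proof: `⟪v, w × c⟫ = ⟪c, v × w⟫`, so the left side is `⟪c, z⟫` with `z = ±α (v × w) ± β v`; since
`v × w ⊥ v`, `‖z‖² = α²‖v × w‖² + β²‖v‖² ≤ ‖v‖²(α²‖w‖² + β²)`. (In the application `c = curl w`: the Lamb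
integrand sees the component of `v` orthogonal to `curl w`, the strain-cube term the component along it.)
[folklore] -/
theorem abs_lamb_add_abs_axial_le_normSq (v w c : EuclideanSpace ℝ (Fin 3)) (α β : ℝ) :
    α * |⟪v, cross w c⟫| + β * |⟪v, c⟫| ≤ ‖c‖ * Real.sqrt (α ^ 2 * ‖cross v w‖ ^ 2 + β ^ 2 * ‖v‖ ^ 2) := by
  obtain ⟨sQ, hsQ, hsQ2⟩ := exists_sign_mul_eq_abs ⟪v, cross w c⟫
  obtain ⟨sP, hsP, hsP2⟩ := exists_sign_mul_eq_abs ⟪v, c⟫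
  set z : EuclideanSpace ℝ (Fin 3) := (α * sQ) • cross v w + (β * sP) • v with hz
  have hcz : ⟪c, z⟫ = α * |⟪v, cross w c⟫| + β * |⟪v, c⟫| := by
    rw [hz, inner_add_right, inner_smul_right, inner_smul_right, inner_cross_cyclic, real_inner_comm v c,
      ← hsQ, ← hsP]
    ring
  have horth : ⟪cross v w, v⟫ = 0 := inner_cross_curl_left v w
  have hz2 : ‖z‖ ^ 2 = α ^ 2 * ‖cross v w‖ ^ 2 + β ^ 2 * ‖v‖ ^ 2 := by
    rw [hz, norm_add_sq_real, norm_smul, norm_smul, inner_smul_left, inner_smul_right, horth,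
      Real.norm_eq_abs, Real.norm_eq_abs, mul_pow, mul_pow, sq_abs, sq_abs, mul_pow, mul_pow, hsQ2, hsP2]
    simp
  have hzle : ‖z‖ ≤ Real.sqrt (α ^ 2 * ‖cross v w‖ ^ 2 + β ^ 2 * ‖v‖ ^ 2) := by
    rw [← Real.sqrt_sq (norm_nonneg z), hz2]
  calc α * |⟪v, cross w c⟫| + β * |⟪v, c⟫| = ⟪c, z⟫ := hcz.symm
    _ ≤ ‖c‖ * ‖z‖ := real_inner_le_norm _ _
    _ ≤ ‖c‖ * Real.sqrt (α ^ 2 * ‖cross v w‖ ^ 2 + β ^ 2 * ‖v‖ ^ 2) :=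
        mul_le_mul_of_nonneg_left hzle (norm_nonneg _)

variable {v : EuclideanSpace ℝ (Fin 3) → EuclideanSpace ℝ (Fin 3)}
  {s : Fin 3 → Fin 3 → EuclideanSpace ℝ (Fin 3) → ℝ} {N : EuclideanSpace ℝ (Fin 3) → ℝ}

/-! ## The pointwise step of the split chain -/

/-- **The pointwise split bound.** With `|v| ≤ M`, `0 ≤ N`, `Σⱼ(∂ⱼN)² ≤ D`, `0 ≤ λ`, `ω = curl v`,
`c = curl ω`:
`(1−λ)|⟪v, ω × c⟫| + λ(2√6/9)·(−Σᵢⱼ ∂ⱼ(sᵢⱼN) vᵢ) ≤ M(‖c‖ √((1−λ)²‖ω‖² + (λ√6 N/9)²) + λ(2√6/9)√(2/3) √q √D)`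
(the chain's first term is `(λ√6/9) N ⟪v, c⟫`, the joint bound `abs_lamb_add_abs_axial_le` takes it together
with the Lamb integrand; the `S∇N` term keeps its operator-norm bound). [folklore] -/
theorem lamb_split_pointwise_normal (hv : ContDiff ℝ ∞ v) (hdiv : VectorCalculus.IsDivFree v)
    (hs : ∀ i j y, s i j y = (pderiv j (fun z => v z i) y + pderiv i (fun z => v z j) y) / 2)
    (hN : Differentiable ℝ N) {M Mn D lam : ℝ} (hlam0 : 0 ≤ lam)
    (x : EuclideanSpace ℝ (Fin 3)) (hM : ‖v x‖ ≤ M) (hMn : ‖cross (v x) (curl v x)‖ ≤ Mn * ‖curl v x‖)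
    (hN0 : 0 ≤ N x) (hD : ∑ j, pderiv j N x ^ 2 ≤ D) :
    (1 - lam) * |⟪v x, cross (curl v x) (curl (curl v) x)⟫| +
        lam * ((2 / 9) * Real.sqrt 6) * -(∑ i, ∑ j, pderiv j (fun y => s i j y * N y) x * v x i) ≤
      ‖curl (curl v) x‖ *
          Real.sqrt ((1 - lam) ^ 2 * (Mn ^ 2 * ‖curl v x‖ ^ 2) + (lam * (Real.sqrt 6 / 9) * N x) ^ 2 * M ^ 2) +
        M * (lam * ((2 / 9) * Real.sqrt 6) *
          (Real.sqrt (2 / 3) * (Real.sqrt (∑ i, ∑ j, s i j x ^ 2) * Real.sqrt D))) := by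
  rw [sum_pderiv_mul_weight_eq hv hdiv hs hN x]
  obtain ⟨hsym, htr⟩ := sym_symm_trace hv hdiv hs x
  have hM0 : 0 ≤ M := (norm_nonneg _).trans hM
  have h6 : 0 ≤ Real.sqrt 6 := Real.sqrt_nonneg _
  have h23 : 0 ≤ Real.sqrt (2 / 3) := Real.sqrt_nonneg _
  -- the chain's first term is `(λ√6/9)·N·⟪v, c⟫`
  have hhalf : ∑ i, v x i * ((1 / 2) * (Δ v) x i) = (1 / 2) * ∑ i, v x i * (Δ v) x i := by
    rw [Finset.mul_sum]; exact Finset.sum_congr rfl fun i _ => by ring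
  have hP : ∑ i, v x i * (Δ v) x i = -⟪v x, curl (curl v) x⟫ := by
    rw [inner_curl_curl_eq_neg_sum hv hdiv x, neg_neg]
  -- joint bound on the Lamb term and the first chain term
  have hβ : 0 ≤ lam * (Real.sqrt 6 / 9) * N x := by positivity
  have hjoint := abs_lamb_add_abs_axial_le_normSq (v x) (curl v x) (curl (curl v) x) (1 - lam)
    (lam * (Real.sqrt 6 / 9) * N x)
  -- the two amplitudes: `‖v × ω‖ ≤ Mn ‖ω‖`, `‖v‖ ≤ M`
  have hsq : Real.sqrt ((1 - lam) ^ 2 * ‖cross (v x) (curl v x)‖ ^ 2 +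
      (lam * (Real.sqrt 6 / 9) * N x) ^ 2 * ‖v x‖ ^ 2) ≤
      Real.sqrt ((1 - lam) ^ 2 * (Mn ^ 2 * ‖curl v x‖ ^ 2) + (lam * (Real.sqrt 6 / 9) * N x) ^ 2 * M ^ 2) := by
    refine Real.sqrt_le_sqrt (add_le_add ?_ ?_)
    · have h1 : ‖cross (v x) (curl v x)‖ ^ 2 ≤ (Mn * ‖curl v x‖) ^ 2 :=
        pow_le_pow_left₀ (norm_nonneg _) hMn 2
      nlinarith [sq_nonneg (1 - lam)]
    · have h1 : ‖v x‖ ^ 2 ≤ M ^ 2 := pow_le_pow_left₀ (norm_nonneg _) hM 2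
      exact mul_le_mul_of_nonneg_left h1 (sq_nonneg _)
  have a1 : (1 - lam) * |⟪v x, cross (curl v x) (curl (curl v) x)⟫| +
      lam * ((2 / 9) * Real.sqrt 6) * -(N x * ∑ i, v x i * ((1 / 2) * (Δ v) x i)) ≤
      ‖curl (curl v) x‖ *
        Real.sqrt ((1 - lam) ^ 2 * (Mn ^ 2 * ‖curl v x‖ ^ 2) + (lam * (Real.sqrt 6 / 9) * N x) ^ 2 * M ^ 2) := by
    have e : lam * ((2 / 9) * Real.sqrt 6) * -(N x * ∑ i, v x i * ((1 / 2) * (Δ v) x i)) =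
        lam * (Real.sqrt 6 / 9) * N x * ⟪v x, curl (curl v) x⟫ := by
      rw [hhalf, hP]; ring
    rw [e]
    have h2 : lam * (Real.sqrt 6 / 9) * N x * ⟪v x, curl (curl v) x⟫ ≤
        lam * (Real.sqrt 6 / 9) * N x * |⟪v x, curl (curl v) x⟫| :=
      mul_le_mul_of_nonneg_left (le_abs_self _) hβ
    have h3 := mul_le_mul_of_nonneg_left hsq (norm_nonneg (curl (curl v) x))
    linarith [hjoint, h2, h3]
  -- the `S∇N` term, with the operator-norm gain
  have t2 := abs_bilin_sym_le (fun i j => s i j x) hsym htr (fun i => v x i) (fun j => pderiv j N x)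
  have ev : Real.sqrt (∑ i, v x i ^ 2) = ‖v x‖ := by
    rw [← norm_sq_eq_sum_sq, Real.sqrt_sq (norm_nonneg _)]
  rw [ev] at t2
  have hD0 : 0 ≤ D := (sum_nonneg fun _ _ => sq_nonneg _).trans hD
  have hsD : Real.sqrt (∑ j, pderiv j N x ^ 2) ≤ Real.sqrt D := Real.sqrt_le_sqrt hD
  have hq0 : 0 ≤ Real.sqrt (∑ i, ∑ j, s i j x ^ 2) := Real.sqrt_nonneg _
  have a2 : lam * ((2 / 9) * Real.sqrt 6) * -(∑ i, v x i * ∑ j, s i j x * pderiv j N x) ≤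
      M * (lam * ((2 / 9) * Real.sqrt 6) *
        (Real.sqrt (2 / 3) * (Real.sqrt (∑ i, ∑ j, s i j x ^ 2) * Real.sqrt D))) := by
    have h := neg_abs_le (∑ i, v x i * ∑ j, s i j x * pderiv j N x)
    have h2 : Real.sqrt (2 / 3) * Real.sqrt (∑ i, ∑ j, s i j x ^ 2) * ‖v x‖ *
        Real.sqrt (∑ j, pderiv j N x ^ 2) ≤
        Real.sqrt (2 / 3) * Real.sqrt (∑ i, ∑ j, s i j x ^ 2) * M * Real.sqrt D :=
      mul_le_mul (mul_le_mul_of_nonneg_left hM (by positivity)) hsD (Real.sqrt_nonneg _) (by positivity)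
    have hc : 0 ≤ lam * ((2 / 9) * Real.sqrt 6) := by positivity
    have h4 : -(∑ i, v x i * ∑ j, s i j x * pderiv j N x) ≤
        M * (Real.sqrt (2 / 3) * (Real.sqrt (∑ i, ∑ j, s i j x ^ 2) * Real.sqrt D)) := by
      linarith [t2]
    calc lam * ((2 / 9) * Real.sqrt 6) * -(∑ i, v x i * ∑ j, s i j x * pderiv j N x)
        ≤ lam * ((2 / 9) * Real.sqrt 6) *
          (M * (Real.sqrt (2 / 3) * (Real.sqrt (∑ i, ∑ j, s i j x ^ 2) * Real.sqrt D))) :=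
          mul_le_mul_of_nonneg_left h4 hc
      _ = _ := by ring
  rw [neg_add, mul_add]
  linarith [a1, a2]

/-! ## The two-amplitude split chain at a fixed weight -/

/-- **The two-amplitude split chain at a fixed admissible weight `N`.** As `lamb_split_weight_le`, with the
extra datum `‖v × ω‖ ≤ M_⊥‖ω‖` pointwise: for `0 ≤ λ ≤ 1`,
`(1−λ)|∫⟪curl v, Dv curl v⟫| + λ(2√6/9)∫qN ≤
  √(∫‖curl curl v‖²) √((1−λ)²M_⊥²∫‖curl v‖² + (λ√6/9)²M²∫q) + M·λ(2√6/9)√(2/3) √(∫q) √(∫Σ(∂ₗsᵢⱼ)²)`.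
[folklore] -/
theorem lamb_split_weight_le_normal (hv : ContDiff ℝ ∞ v) (hdiv : VectorCalculus.IsDivFree v)
    {M Mn B : ℝ} (hM : ∀ x, ‖v x‖ ≤ M) (hMn : ∀ x, ‖cross (v x) (curl v x)‖ ≤ Mn * ‖curl v x‖)
    (hB : ∀ x, ‖fderiv ℝ v x‖ ≤ B)
    (h1 : ∫⁻ x, ‖iteratedFDeriv ℝ 1 v x‖ₑ ^ 2 < ⊤) (h2 : ∫⁻ x, ‖iteratedFDeriv ℝ 2 v x‖ₑ ^ 2 < ⊤)
    (hs : ∀ i j y, s i j y = (pderiv j (fun z => v z i) y + pderiv i (fun z => v z j) y) / 2)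
    (hNC : ContDiff ℝ ∞ N) (hN0 : ∀ x, 0 ≤ N x)
    (hNq : ∀ x, N x ≤ Real.sqrt (∑ i, ∑ j, s i j x ^ 2))
    (hNle : ∀ x, N x ≤ 3 * ‖iteratedFDeriv ℝ 1 v x‖)
    (hdN : ∀ l x, |pderiv l N x| ≤ 6 * ‖iteratedFDeriv ℝ 2 v x‖)
    (hdND : ∀ x, ∑ l, pderiv l N x ^ 2 ≤ ∑ l, ∑ i, ∑ j, pderiv l (s i j) x ^ 2)
    {lam : ℝ} (hlam0 : 0 ≤ lam) (hlam1 : lam ≤ 1) :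
    (1 - lam) * |∫ x, ⟪curl v x, fderiv ℝ v x (curl v x)⟫| +
        lam * ((2 / 9) * Real.sqrt 6) * ∫ x, (∑ i, ∑ j, s i j x ^ 2) * N x ≤
      Real.sqrt (∫ x, ‖curl (curl v) x‖ ^ 2) *
          Real.sqrt ((1 - lam) ^ 2 * (Mn ^ 2 * ∫ x, ‖curl v x‖ ^ 2) +
            (lam * (Real.sqrt 6 / 9)) ^ 2 * M ^ 2 * ∫ x, ∑ i, ∑ j, s i j x ^ 2) +
        M * (lam * ((2 / 9) * Real.sqrt 6) * (Real.sqrt (2 / 3) *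
          (Real.sqrt (∫ x, ∑ i, ∑ j, s i j x ^ 2) *
            Real.sqrt (∫ x, ∑ l, ∑ i, ∑ j, pderiv l (s i j) x ^ 2)))) := by
  have hM0 : 0 ≤ M := (norm_nonneg _).trans (hM 0)
  have hsC := contDiff_sym hv hs
  have hNd : Differentiable ℝ N := hNC.differentiable (by simp)
  have cN : Continuous N := hNC.continuous
  have hv2 : ContDiff ℝ 2 v := hv.of_le (by norm_cast)
  have hv1 : ContDiff ℝ 1 v := hv.of_le (by norm_cast)
  -- vorticity, its curl, integrability of the Lamb pairing
  have hω1 : ContDiff ℝ 1 (curl v) := by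
    rw [curl_eq_curlCLM_comp]
    exact curlCLM.contDiff.comp (hv2.fderiv_right (m := 1) (by norm_cast))
  have cω : Continuous (curl v) := hω1.continuous
  have cc : Continuous (curl (curl v)) := by
    have : curl (curl v) = fun x => -(Δ v) x := funext fun x => curl_curl_eq_neg_laplacian hv2 hdiv x
    rw [this]; exact (continuous_laplacian_of hv).neg
  have T1eq : ∀ x, ‖fderiv ℝ v x‖ = ‖iteratedFDeriv ℝ 1 v x‖ := fun x => norm_fderiv_eq_norm_iteratedFDeriv_one x
  have ω_le : ∀ x, ‖curl v x‖ ≤ ‖curlCLM‖ * ‖iteratedFDeriv ℝ 1 v x‖ := fun x => by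
    rw [← T1eq]; exact norm_curl_le v x
  have c_le : ∀ x, ‖curl (curl v) x‖ ≤ 6 * ‖iteratedFDeriv ℝ 2 v x‖ := fun x => by
    rw [curl_curl_eq_neg_laplacian hv2 hdiv x, norm_neg]; exact norm_laplacian_le hv x
  have l2ω : ∫⁻ x, ‖curl v x‖ₑ ^ 2 < ⊤ := by
    refine lintegral_enorm_sq_lt_top_of_norm_le_const_mul ‖curlCLM‖ (fun x => ?_) h1
    rw [← norm_iteratedFDeriv_fderiv, norm_iteratedFDeriv_zero]
    exact norm_curl_le v x
  have iZ : Integrable (fun x => ‖curl v x‖ ^ 2) volume := integrable_sq_norm_of_lintegral_lt_top cω l2ω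
  have iA : Integrable (fun x => frobeniusNormSq (fderiv ℝ (curl v) x)) volume := by
    refine integrable_of_continuous_of_nonneg (continuous_frobeniusNormSq_fderiv hω1 one_ne_zero)
      (fun x => frobeniusNormSq_nonneg _) ?_
    exact (lintegral_ofReal_frobeniusNormSq_fderiv_curl_le hv2).trans_lt
      (ENNReal.mul_lt_top (ENNReal.mul_lt_top (by norm_num) ENNReal.ofReal_lt_top) h2)
  have iJ : Integrable (fun x => ⟪curl v x, fderiv ℝ v x (curl v x)⟫) volume := by
    refine integrable_of_norm_le_const_mul_mul B
      (cω.inner ((hv1.continuous_fderiv one_ne_zero).clm_apply cω)) cω cω l2ω l2ω fun x => ?_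
    calc ‖⟪curl v x, fderiv ℝ v x (curl v x)⟫‖ ≤ ‖curl v x‖ * ‖fderiv ℝ v x (curl v x)‖ :=
          norm_inner_le_norm _ _
      _ ≤ ‖curl v x‖ * (B * ‖curl v x‖) :=
          mul_le_mul_of_nonneg_left ((fderiv ℝ v x).le_of_opNorm_le (hB x) _) (norm_nonneg _)
      _ = B * ‖curl v x‖ * ‖curl v x‖ := by ring
  have hLamb := integral_stretching_eq_integral_inner_cross hv2 hdiv hM iZ iA iJ
  have iL : Integrable (fun x => ⟪v x, cross (curl v x) (curl (curl v) x)⟫) volume :=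
    integrable_inner_cross_curl hv2 hM iZ iA
  -- the chain side: the IBP identity and the pointwise bound
  have P := integrable_ibp_products hv hM hB h1 h2 hs hNC hN0 hNle hdN
  set q : EuclideanSpace ℝ (Fin 3) → ℝ := fun x => ∑ i, ∑ j, s i j x ^ 2 with hq
  set Dg : EuclideanSpace ℝ (Fin 3) → ℝ := fun x => ∑ l, ∑ i, ∑ j, pderiv l (s i j) x ^ 2 with hDg
  have cq : Continuous q := continuous_finsetSum _ fun i _ => continuous_finsetSum _ fun j _ =>
    ((hsC i j).continuous).pow 2
  have cDg : Continuous Dg := continuous_finsetSum _ fun l _ => continuous_finsetSum _ fun i _ =>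
    continuous_finsetSum _ fun j _ => ((contDiff_pderiv (hsC i j) l).continuous).pow 2
  have hq0 : ∀ x, 0 ≤ q x := fun x => sumSq_nonneg (s := s) x
  have hDg0 : ∀ x, 0 ≤ Dg x := fun x =>
    sum_nonneg fun l _ => sumSq_nonneg (s := fun i j y => pderiv l (s i j) y) x
  have iq : Integrable q := by
    refine integrable_of_le_iteratedFDeriv_mul hv h1 h1 cq 9 fun x => ?_
    rw [abs_of_nonneg (hq0 x)]
    nlinarith [sumSq_sym_le hv hs x]
  have iDg : Integrable Dg := by
    refine integrable_of_le_iteratedFDeriv_mul hv h2 h2 cDg 27 fun x => ?_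
    rw [abs_of_nonneg (hDg0 x)]
    nlinarith [gradSq_sym_le hv hs x]
  -- the weight `g = (1−λ)²M_⊥²‖ω‖² + (λ√6 N/9)² M²` of the joint bound
  set β : ℝ := lam * (Real.sqrt 6 / 9) with hβ
  have hβ0 : 0 ≤ β := by positivity
  have hβ1 : β ≤ 1 := by
    have h6 : Real.sqrt 6 ≤ 3 := by
      rw [show (3:ℝ) = Real.sqrt (3 ^ 2) by rw [Real.sqrt_sq (by norm_num)]]
      exact Real.sqrt_le_sqrt (by norm_num)
    rw [hβ]; nlinarith [Real.sqrt_nonneg 6]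
  set g : EuclideanSpace ℝ (Fin 3) → ℝ :=
    fun x => (1 - lam) ^ 2 * (Mn ^ 2 * ‖curl v x‖ ^ 2) + (β * N x) ^ 2 * M ^ 2 with hg
  have hg0 : ∀ x, 0 ≤ g x := fun x => by positivity
  have cg : Continuous g :=
    (((cω.norm.pow 2).const_mul _).const_mul _).add (((cN.const_mul _).pow 2).mul continuous_const)
  set K : ℝ := Mn ^ 2 * ‖curlCLM‖ ^ 2 + 9 * M ^ 2 with hK
  have hK0 : 0 ≤ K := by positivity
  have g_le : ∀ x, g x ≤ K * ‖iteratedFDeriv ℝ 1 v x‖ ^ 2 := by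
    intro x
    have h1' : (1 - lam) ^ 2 * (Mn ^ 2 * ‖curl v x‖ ^ 2) ≤
        Mn ^ 2 * ‖curlCLM‖ ^ 2 * ‖iteratedFDeriv ℝ 1 v x‖ ^ 2 := by
      have a : (1 - lam) ^ 2 ≤ 1 := by nlinarith
      have b : ‖curl v x‖ ^ 2 ≤ (‖curlCLM‖ * ‖iteratedFDeriv ℝ 1 v x‖) ^ 2 :=
        pow_le_pow_left₀ (norm_nonneg _) (ω_le x) 2
      have c0 : 0 ≤ Mn ^ 2 * ‖curl v x‖ ^ 2 := by positivity
      nlinarith [sq_nonneg Mn]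
    have h2' : (β * N x) ^ 2 * M ^ 2 ≤ 9 * M ^ 2 * ‖iteratedFDeriv ℝ 1 v x‖ ^ 2 := by
      have b : β * N x ≤ 1 * (3 * ‖iteratedFDeriv ℝ 1 v x‖) :=
        mul_le_mul hβ1 (hNle x) (hN0 x) zero_le_one
      have b0 : 0 ≤ β * N x := mul_nonneg hβ0 (hN0 x)
      have b2 : (β * N x) ^ 2 ≤ 9 * ‖iteratedFDeriv ℝ 1 v x‖ ^ 2 := by nlinarith
      nlinarith [sq_nonneg M]
    rw [hg, hK]; simp only; nlinarith
  have ig : Integrable g := by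
    refine integrable_of_le_iteratedFDeriv_mul hv h1 h1 cg K fun x => ?_
    rw [abs_of_nonneg (hg0 x)]
    nlinarith [g_le x]
  have sqrt_g_le : ∀ x, Real.sqrt (g x) ≤ Real.sqrt K * ‖iteratedFDeriv ℝ 1 v x‖ := by
    intro x
    rw [← Real.sqrt_sq (norm_nonneg (iteratedFDeriv ℝ 1 v x)), ← Real.sqrt_mul hK0]
    exact Real.sqrt_le_sqrt (g_le x)
  have icg : Integrable (fun x => ‖curl (curl v) x‖ * Real.sqrt (g x)) := by
    refine integrable_of_le_iteratedFDeriv_mul hv h2 h1 (cc.norm.mul (Real.continuous_sqrt.comp cg))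
      (6 * Real.sqrt K) fun x => ?_
    rw [abs_mul, abs_of_nonneg (norm_nonneg _), abs_of_nonneg (Real.sqrt_nonneg _)]
    calc ‖curl (curl v) x‖ * Real.sqrt (g x)
        ≤ (6 * ‖iteratedFDeriv ℝ 2 v x‖) * (Real.sqrt K * ‖iteratedFDeriv ℝ 1 v x‖) :=
          mul_le_mul (c_le x) (sqrt_g_le x) (Real.sqrt_nonneg _) (by positivity)
      _ = 6 * Real.sqrt K * ‖iteratedFDeriv ℝ 2 v x‖ * ‖iteratedFDeriv ℝ 1 v x‖ := by ring
  have ic2 : Integrable (fun x => ‖curl (curl v) x‖ ^ 2) := by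
    refine integrable_of_le_iteratedFDeriv_mul hv h2 h2 (cc.norm.pow 2) 36 fun x => ?_
    rw [abs_of_nonneg (sq_nonneg _)]
    nlinarith [c_le x, norm_nonneg (curl (curl v) x)]
  have iqD : Integrable fun x => Real.sqrt (q x) * Real.sqrt (Dg x) := by
    refine integrable_of_le_iteratedFDeriv_mul hv h1 h2 ((Real.continuous_sqrt.comp cq).mul
      (Real.continuous_sqrt.comp cDg)) 18 fun x => ?_
    rw [abs_mul, abs_of_nonneg (Real.sqrt_nonneg _), abs_of_nonneg (Real.sqrt_nonneg _)]
    nlinarith [mul_le_mul (sqrt_sumSq_sym_le hv hs x) (sqrt_gradSq_sym_le hv hs x) (Real.sqrt_nonneg _)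
      (by positivity : (0:ℝ) ≤ 3 * ‖iteratedFDeriv ℝ 1 v x‖)]
  -- the pointwise bound, integrated
  have iS : Integrable fun x => ∑ i, ∑ j, pderiv j (fun y => s i j y * N y) x * v x i :=
    integrable_finsetSum _ fun i _ => integrable_finsetSum _ fun j _ => (P i j).1
  have hpt : ∀ x, (1 - lam) * |⟪v x, cross (curl v x) (curl (curl v) x)⟫| +
      lam * ((2 / 9) * Real.sqrt 6) * -(∑ i, ∑ j, pderiv j (fun y => s i j y * N y) x * v x i) ≤
      ‖curl (curl v) x‖ * Real.sqrt (g x) +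
        M * (lam * ((2 / 9) * Real.sqrt 6) * (Real.sqrt (2 / 3) * (Real.sqrt (q x) * Real.sqrt (Dg x)))) :=
    fun x => lamb_split_pointwise_normal hv hdiv hs hNd hlam0 x (hM x) (hMn x) (hN0 x) (hdND x)
  have iSn : Integrable fun x => -(∑ i, ∑ j, pderiv j (fun y => s i j y * N y) x * v x i) := iS.neg
  have iL1 : Integrable fun x => (1 - lam) * |⟪v x, cross (curl v x) (curl (curl v) x)⟫| :=
    iL.abs.const_mul _
  have iS1 : Integrable fun x =>
      lam * ((2 / 9) * Real.sqrt 6) * -(∑ i, ∑ j, pderiv j (fun y => s i j y * N y) x * v x i) :=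
    iSn.const_mul _
  have iLHS : Integrable fun x => (1 - lam) * |⟪v x, cross (curl v x) (curl (curl v) x)⟫| +
      lam * ((2 / 9) * Real.sqrt 6) * -(∑ i, ∑ j, pderiv j (fun y => s i j y * N y) x * v x i) :=
    iL1.add iS1
  have iR2 : Integrable fun x =>
      M * (lam * ((2 / 9) * Real.sqrt 6) * (Real.sqrt (2 / 3) * (Real.sqrt (q x) * Real.sqrt (Dg x)))) :=
    ((iqD.const_mul _).const_mul _).const_mul M
  have iRHS : Integrable fun x => ‖curl (curl v) x‖ * Real.sqrt (g x) +
      M * (lam * ((2 / 9) * Real.sqrt 6) * (Real.sqrt (2 / 3) * (Real.sqrt (q x) * Real.sqrt (Dg x)))) :=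
    icg.add iR2
  have step1 := integral_mono iLHS iRHS hpt
  rw [integral_add iL1 iS1, integral_const_mul, integral_const_mul,
    integral_neg, integral_add icg iR2, integral_const_mul, integral_const_mul, integral_const_mul] at step1
  -- left side: Lamb pairing and the IBP identity
  have hJ : |∫ x, ⟪curl v x, fderiv ℝ v x (curl v x)⟫| ≤
      ∫ x, |⟪v x, cross (curl v x) (curl (curl v) x)⟫| := by
    rw [hLamb]; exact abs_integral_le_integral_abs
  have hIBP : ∫ x, q x * N x = -∫ x, ∑ i, ∑ j, pderiv j (fun y => s i j y * N y) x * v x i :=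
    integral_sumSq_mul_weight_eq hv hM hB h1 h2 hs hNC hN0 hNle hdN
  -- right side: Cauchy–Schwarz twice
  have isg2 : Integrable fun x => Real.sqrt (g x) ^ 2 :=
    ig.congr (Eventually.of_forall fun x => (Real.sq_sqrt (hg0 x)).symm)
  have cs1 : ∫ x, ‖curl (curl v) x‖ * Real.sqrt (g x) ≤
      Real.sqrt (∫ x, ‖curl (curl v) x‖ ^ 2) * Real.sqrt (∫ x, g x) := by
    have h := integral_mul_le_sqrt_mul_sqrt (μ := volume) (fun x => norm_nonneg (curl (curl v) x))
      (fun x => Real.sqrt_nonneg (g x)) cc.norm.aestronglyMeasurable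
      (Real.continuous_sqrt.comp cg).aestronglyMeasurable ic2 isg2
    have e2 : ∫ x, Real.sqrt (g x) ^ 2 = ∫ x, g x :=
      integral_congr_ae (Eventually.of_forall fun x => Real.sq_sqrt (hg0 x))
    rw [e2] at h
    exact h
  have isq2 : Integrable fun x => Real.sqrt (q x) ^ 2 :=
    iq.congr (Eventually.of_forall fun x => (Real.sq_sqrt (hq0 x)).symm)
  have isD2 : Integrable fun x => Real.sqrt (Dg x) ^ 2 :=
    iDg.congr (Eventually.of_forall fun x => (Real.sq_sqrt (hDg0 x)).symm)
  have cs2 : ∫ x, Real.sqrt (q x) * Real.sqrt (Dg x) ≤ Real.sqrt (∫ x, q x) * Real.sqrt (∫ x, Dg x) := by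
    have h := integral_mul_le_sqrt_mul_sqrt (μ := volume) (fun x => Real.sqrt_nonneg (q x))
      (fun x => Real.sqrt_nonneg (Dg x)) (Real.continuous_sqrt.comp cq).aestronglyMeasurable
      (Real.continuous_sqrt.comp cDg).aestronglyMeasurable isq2 isD2
    have e1 : ∫ x, Real.sqrt (q x) ^ 2 = ∫ x, q x :=
      integral_congr_ae (Eventually.of_forall fun x => Real.sq_sqrt (hq0 x))
    have e2 : ∫ x, Real.sqrt (Dg x) ^ 2 = ∫ x, Dg x :=
      integral_congr_ae (Eventually.of_forall fun x => Real.sq_sqrt (hDg0 x))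
    rw [e1, e2] at h
    exact h
  -- `∫ g ≤ (1−λ)² M_⊥² Z + β² M² ∫q`
  have N2_le : ∀ x, N x ^ 2 ≤ q x := fun x => by
    calc N x ^ 2 ≤ Real.sqrt (q x) ^ 2 := pow_le_pow_left₀ (hN0 x) (hNq x) 2
      _ = q x := Real.sq_sqrt (hq0 x)
  have iN2 : Integrable fun x => N x ^ 2 := by
    refine iq.mono' (cN.pow 2).aestronglyMeasurable (Eventually.of_forall fun x => ?_)
    rw [Real.norm_of_nonneg (sq_nonneg _)]
    exact N2_le x
  have hg_int : ∫ x, g x ≤ (1 - lam) ^ 2 * (Mn ^ 2 * ∫ x, ‖curl v x‖ ^ 2) + β ^ 2 * M ^ 2 * ∫ x, q x := by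
    have e : ∫ x, g x = (1 - lam) ^ 2 * (Mn ^ 2 * ∫ x, ‖curl v x‖ ^ 2) + β ^ 2 * M ^ 2 * ∫ x, N x ^ 2 := by
      rw [hg]; simp only
      rw [integral_add ((iZ.const_mul _).const_mul _) ((iN2.const_mul (β ^ 2 * M ^ 2)).congr
        (Eventually.of_forall fun x => by simp only; ring)), integral_const_mul, integral_const_mul]
      congr 1
      rw [show (fun x => (β * N x) ^ 2 * M ^ 2) = fun x => (β ^ 2 * M ^ 2) * N x ^ 2 from
        funext fun x => by ring, integral_const_mul]
    rw [e]
    have := integral_mono iN2 iq N2_le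
    have hc : 0 ≤ β ^ 2 * M ^ 2 := by positivity
    nlinarith
  have hsg : Real.sqrt (∫ x, g x) ≤
      Real.sqrt ((1 - lam) ^ 2 * (Mn ^ 2 * ∫ x, ‖curl v x‖ ^ 2) + β ^ 2 * M ^ 2 * ∫ x, q x) :=
    Real.sqrt_le_sqrt hg_int
  have hc0 : 0 ≤ Real.sqrt (∫ x, ‖curl (curl v) x‖ ^ 2) := Real.sqrt_nonneg _
  have hlamc : 0 ≤ lam * ((2 / 9) * Real.sqrt 6) := by positivity
  have h23 : 0 ≤ Real.sqrt (2 / 3) := Real.sqrt_nonneg _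
  calc (1 - lam) * |∫ x, ⟪curl v x, fderiv ℝ v x (curl v x)⟫| +
        lam * ((2 / 9) * Real.sqrt 6) * ∫ x, q x * N x
      ≤ ((1 - lam) * ∫ x, |⟪v x, cross (curl v x) (curl (curl v) x)⟫|) +
          lam * ((2 / 9) * Real.sqrt 6) * -(∫ x, ∑ i, ∑ j, pderiv j (fun y => s i j y * N y) x * v x i) := by
        rw [hIBP]
        exact add_le_add (mul_le_mul_of_nonneg_left hJ (sub_nonneg.2 hlam1)) le_rfl
    _ ≤ (∫ x, ‖curl (curl v) x‖ * Real.sqrt (g x)) +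
          M * (lam * ((2 / 9) * Real.sqrt 6) * (Real.sqrt (2 / 3) *
            ∫ x, Real.sqrt (q x) * Real.sqrt (Dg x))) := step1
    _ ≤ Real.sqrt (∫ x, ‖curl (curl v) x‖ ^ 2) *
          Real.sqrt ((1 - lam) ^ 2 * (Mn ^ 2 * ∫ x, ‖curl v x‖ ^ 2) + β ^ 2 * M ^ 2 * ∫ x, q x) +
        M * (lam * ((2 / 9) * Real.sqrt 6) * (Real.sqrt (2 / 3) *
          (Real.sqrt (∫ x, q x) * Real.sqrt (∫ x, Dg x)))) := by
        refine add_le_add ?_ ?_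
        · exact cs1.trans (mul_le_mul_of_nonneg_left hsg hc0)
        · exact mul_le_mul_of_nonneg_left
            (mul_le_mul_of_nonneg_left (mul_le_mul_of_nonneg_left cs2 h23) hlamc) hM0


end Summit.NavierStokesRegularity.NavierStokesRegularity.Theorems.DepletionLadder.StrainCube

end
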